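import Summits.CriticalPhenomena.Ising3DConformalLimit.Theses.OctantEntropy
import Summits.CriticalPhenomena.Ising3DConformalLimit.Theses.HyperoctahedralRP
import Summits.CriticalPhenomena.Ising3DConformalLimit.Theses.PerfectScreening
import Summits.CriticalPhenomena.Ising3DConformalLimit.Theorems.EnergyNotSigmaSquaredMoebiusLimitExistsHrpFactorisation
import Summits.CriticalPhenomena.Ising3DConformalLimit.Theorems.HyperoctahedralRPLimitRotationInvariant
import HarnessLib
import HarnessLib.Audit

/-!
# Birth skeleton (BC3) for crux `EtaToMoebiusLimit` — item stmt-CriticalPhenomena-5735, route `OctantEntropy`, rank 5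

Registered file `Cruxes/EtaToMoebiusLimit/Lines/birth.lean` (planner-skel-stmt-CriticalPhenomena-5735-0, 2026-08-17).

THE CRUX (by name `OctantEntropy.EtaToMoebiusLimit`; imported complement of the route, grounded g13-38,
route-review ec82786d):

  `(∃ η, HasIsingExponentEta 3 η) → ∃ ρ Δ S, (∀ δ ∈ (0,1], 0 < ρ δ) ∧ 0 < Δ ∧
      HasPointwiseScalingLimit (criticalCorr 3) ρ S ∧ IsNondegenerateTwoPoint S ∧ IsMoebiusCovariant Δ S`

i.e. literally `OctantEntropy.EtaExists → PerfectScreening.MoebiusLimitExists` (item 0635 → item 1344; the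
antecedent and the consequent are those decls VERBATIM, so both arrows below are definitional).

THE LINE (η-conditional HRP factorisation). In tree, item 1344 factors EXACTLY through the three cruxes of route
`HyperoctahedralRP` (`MoebiusLimitExistsOnlyInteraction.MoebiusLimitExists_iff_hrp`, Theorems/…HrpFactorisation):
1344 ⟺ 1981 `ExistsScaleCovariantLimit` ∧ 1980 `LimitRotationInvariant` ∧ 1982 `InversionUpgradeNormalised`,
and 1980 is a THEOREM (`Cruxes.LimitRotationInvariant.QuarterTurnLiouville.LimitRotationInvariant_of`, with its
hypothesis `HRP2Rigidity` = item 1979 also proved, `HRP2Rigidity_of`). Conditioning on `EtaExists` therefore cuts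
the crux into exactly two open pieces, each NECESSARY for it (crux ⇒ stub: compose the crux witness with
`existsScaleCovariantLimit_of_MoebiusLimitExists` / `inversionUpgradeNormalised_of_MoebiusLimitExists`; checked
sorry-free in the planner's `bc/exactness.lean`) and jointly SUFFICIENT (the skeleton theorem below):

* STUB 1 `stub_existsScaleCovariantLimit_of_eta` : `EtaExists → ExistsScaleCovariantLimit` (0635 → 1981) —
  EXISTENCE given the anomalous dimension: a normalised, non-degenerate, translation-invariant, scale-covariant
  pointwise limit of the critical `ℤ³` correlators exists. This is where `η` is load-bearing: by the tree theorem
  `isingScalingRelationHolds_holds` every scale-covariant non-degenerate limit has `Δ = (1+η)/2` (no competing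
  dimensions across subsequential limits) and `ρ(δ) = δ^{-(1+η)/2+o(1)}`; what remains is tightness of the
  pinned zoom (two-point doubling at ALL scales) and uniqueness of its cluster points — the crux chain of item
  1981 (`Cruxes/ExistsScaleCovariantLimit`, live line `monotone-blocking-port`; in tree 1981 ⟺ TwoPointDoubling
  (6150) ∧ pointwise limit (6153)). Strictly weaker than 1981 itself.
* STUB 2 `stub_inversionUpgradeNormalised_of_eta` : `EtaExists → InversionUpgradeNormalised` (0635 → 1982) —
  the INVERSION UPGRADE (Polyakov) of every normalised, non-degenerate, Euclidean-invariant, scale-covariant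
  limit, allowed to use `η`. The model-blind form is false (`Literature.Barriers.CriticalPhenomena.
  ScaleCovarianceNotMoebius`; `not_inversionUpgrade_of_euclideanLimit` for the un-normalised typing), so a proof
  must use the Ising lattice (RP + locality / no Δ = 2 virial current); crux chain of item 1982
  (`Cruxes/InversionUpgradeNormalised`, line `free-endpoint-gaussian-closure`). Closes by `fun _ => h1982` the
  day item 1982 lands.

COMPOSITION (`EtaToMoebiusLimit_of`, kernel-checked, no sorry of its own): given `hη`, STUB 1 gives the
1981-witness `(ρ, Δ, S)`; `LimitRotationInvariant_of` (1980, proved) makes it `O(3)`-invariant, hence Euclidean;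
STUB 2 makes it inversion covariant; Möbius covariance is the conjunction — this is
`MoebiusLimitExists_of_hrp (stub₁ hη) LimitRotationInvariant_of (stub₂ hη)`.

DISPROOF USED. No `Cruxes/EtaToMoebiusLimit/Disproof.lean` exists yet (crux dir empty at registration). The
standing disproof of the CONSEQUENT (`Cruxes/MoebiusLimitExists/Disproof.lean`, item 1344) is honoured: its
`crux_iff_normalised` / `crux_iff_rotation_inversion` / `MoebiusLimitExists_iff_hrp` say the content of 1344 is
exactly existence + inversion once rotations are free — the two stubs; no stub is an instance of a landed
`Theorems/MoebiusLimitExists/Negative/*` refutation (those refute strengthenings: `Δ ∉ [1/2,3/4]`, bounded `ρ`,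
convergence / non-degeneracy / inversion demanded ON the coincident locus or at the origin, uniform convergence —
none is asserted here; both stubs keep the 1981/1982 typings with normalisation, which the refutation file of
route IsingEuclidUpgrade prescribes).

BC3 PROBES (planner folder `bc/EtaToMoebiusLimit_probes.lean`): for each stub signature `T`,
`T → OctantEntropy.EtaToMoebiusLimit` and `T → Ising3DConformalLimit` by
`first | exact? | simpa [·] | (unfold ·; simpa) | aesop` FAIL (4/4): STUB 1 lacks the inversion upgrade, STUB 2
lacks existence, and the summit needs clause (iii) `HasNontrivialU4` (item 0636) on top.

Sorries: exactly two, inside `stub_existsScaleCovariantLimit_of_eta` and `stub_inversionUpgradeNormalised_of_eta`.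
-/

noncomputable section

namespace Summit.CriticalPhenomena.Ising3DConformalLimit.Cruxes.EtaToMoebiusLimit.Birth

open Summit.CriticalPhenomena.Ising3DConformalLimit.Theses

/-! ## The two registered stubs -/

/-- **STUB 1 — existence of the scale-covariant limit, given `η` (item 0635 → item 1981).**
If the anomalous dimension `η(3)` exists (`HasIsingExponentEta 3 η`, log sense), then the critical Ising
correlators on `ℤ³` have, for some renormalisation `ρ > 0` on `(0,1]` and some `Δ > 0`, a pointwise scaling limit
`S` (all `n`, locally uniformly off the diagonals) which is normalised (`S = 0` off `NonCoincident`), has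
non-degenerate two-point function, is translation invariant and scale covariant with dimension `Δ`
(necessarily `Δ = (1+η)/2`, `isingScalingRelationHolds_holds`). Open (Duminil-Copin ICM 2022 §8.4 p. 29:
existence of the limit on `ℤ³` is "widely open"); `η` removes the competition of dimensions between subsequential
limits but not the tightness / uniqueness problem (crux chain of item 1981).
[cite: DuminilCopinICM2022, §8.1 eq. (8.1) and §8.4 p. 29] -/
theorem stub_existsScaleCovariantLimit_of_eta :
    OctantEntropy.EtaExists → HyperoctahedralRP.ExistsScaleCovariantLimit := by
  sorry

/-- **STUB 2 — the inversion upgrade, given `η` (item 0635 → item 1982).**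
If `η(3)` exists, then every pointwise scaling limit `S` of the critical `ℤ³` correlators (`ρ > 0` on `(0,1]`)
that is normalised, non-degenerate, Euclidean invariant and scale covariant with `Δ` is inversion covariant with
the same `Δ` (hence Möbius covariant). Polyakov's postulate for Ising₃; the model-blind statement is FALSE
(free Maxwell field in `d = 3`, El-Showk–Nakayama–Rychkov 2011; tree barrier `ScaleCovarianceNotMoebius`), so the
Ising hypothesis (reflection positivity + locality, absence of a dimension-2 virial current) must be used;
`η` is offered as an extra handle (it pins `Δ`). Equal to item 1982 under the open hypothesis 0635.
[cite: PolandRychkovVichi2019, §II eq. (2)] -/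
theorem stub_inversionUpgradeNormalised_of_eta :
    OctantEntropy.EtaExists → HyperoctahedralRP.InversionUpgradeNormalised := by
  sorry

/-! ## The composition -/

/-- The two pieces give `0635 → 1344` (pure logic plus the PROVED item 1980 `LimitRotationInvariant_of` inside
`MoebiusLimitExists_of_hrp`): the stub signatures appear here as explicit hypotheses. No `sorry`.
[cite: FrancescoMathieuSenechal1997, §4.3.1 eq. (4.62)] -/
theorem moebiusLimitExists_of_pieces
    (h₁ : OctantEntropy.EtaExists → HyperoctahedralRP.ExistsScaleCovariantLimit)
    (h₂ : OctantEntropy.EtaExists → HyperoctahedralRP.InversionUpgradeNormalised)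
    (hη : OctantEntropy.EtaExists) : PerfectScreening.MoebiusLimitExists :=
  MoebiusLimitExistsOnlyInteraction.MoebiusLimitExists_of_hrp (h₁ hη)
    Cruxes.LimitRotationInvariant.QuarterTurnLiouville.LimitRotationInvariant_of (h₂ hη)

/-- **THE SKELETON THEOREM** — concludes the crux `OctantEntropy.EtaToMoebiusLimit` BY NAME from the two
registered stubs (its antecedent is `OctantEntropy.EtaExists` and its consequent `PerfectScreening.MoebiusLimitExists`
verbatim, so `moebiusLimitExists_of_pieces` applies definitionally). [folklore] -/
theorem EtaToMoebiusLimit_of : OctantEntropy.EtaToMoebiusLimit := by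
  intro hη
  exact moebiusLimitExists_of_pieces stub_existsScaleCovariantLimit_of_eta
    stub_inversionUpgradeNormalised_of_eta hη

end Summit.CriticalPhenomena.Ising3DConformalLimit.Cruxes.EtaToMoebiusLimit.Birth

end
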